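import Summits.NavierStokesRegularity.NavierStokesRegularity.Theorems.CircuitPump.Negative.LoadBearing

/-!
# DSS extension of a one-period witness
# (crux `PerpetualPump.CircuitPump`, stmt-NavierStokesRegularity-1834;
# line `singular-clock-gspt`, stub E `stub_dssExtension`)

A one-period witness `Z` of the FULL lattice on `[0, T]` — a solution of Tao's viscous circuit
`rhsF` (`Theorems/CircuitPump/Negative/LoadBearing.lean`) within `Icc 0 T`, with the relative
periodicity `Z i (n+1) T = lam^{-1/5} Z i n 0`, a uniform weighted bound
`lam^{3n/5} |Z i n t| ≤ C` and `Z i n 0 ≠ 0` for some mode — unrolls, by the scaling symmetry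
`X ↦ lam^{-j/5} X_{·,n-j}(lam^{4j/5} ·)` of the circuit class together with time translation, into
an ancient solution `X` on `(-∞, 0)` which solves the circuit ODE, is exactly `1`-DSS, Type I and
nontrivial (`stub_dssExtension`).

Construction. `t⋆ := T·lam^{4/5}/(lam^{4/5} − 1)` (so `lam^{4/5}(t⋆ − T) = t⋆`); the windows
`{t : 0 ≤ lam^{4j/5} t + t⋆ < T}`, `j ∈ ℤ`, tile `(−∞, 0)` (`exists_mem_Ico_zpow`); on window `j`
put `X i n t := lam^{-j/5} Z i (n − j) (lam^{4j/5} t + t⋆)`. Each piece solves the ODE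
(`piece_hasDerivWithinAt`: chain rule + `rpow` bookkeeping), consecutive pieces agree at the
junctions by the relative periodicity, and the two one-sided derivatives there are both `rhsF` of
the common state, so `HasDerivAt` holds everywhere on `(−∞, 0)`. [folklore]
-/

noncomputable section

-- the summit namespace `…NavierStokesRegularity.NavierStokesRegularity…` is the tree convention
set_option linter.dupNamespace false

namespace Summit.NavierStokesRegularity.NavierStokesRegularity.Theorems.PerpetualPumpCircuitPump

open Set Filter Topology
open scoped BigOperators
open Summit.NavierStokesRegularity.NavierStokesRegularity.Theorems.CircuitPumpNegative

/-- **Scaling covariance of Tao's circuit class.** If `Z` solves the circuit within `[0, T]`, then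
the rescaled, translated piece `s ↦ lam^{-j/5} Z i (n - j) (lam^{4j/5} s + t⋆)` solves the same
circuit within the preimage window (chain rule; the weights `lam^{4n/5}`, `lam^{n - [μ = e₃]}` are
exactly compensated by `lam^{-j/5}·lam^{4j/5}` and `lam^{-j/5}·lam^{-j/5}`). [folklore] -/
theorem piece_hasDerivWithinAt {m : ℕ} {lam : ℝ} (hpos : 0 < lam)
    (coeff : Fin m → Fin m → Fin m → Option (Fin 3) → ℝ) (T tstar : ℝ) (Z : Fin m → ℤ → ℝ → ℝ)
    (hZ : ∀ (i : Fin m) (n : ℤ), ∀ t ∈ Icc (0 : ℝ) T,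
      HasDerivWithinAt (Z i n) (rhsF lam coeff Z i n t) (Icc (0 : ℝ) T) t)
    (j : ℤ) (i : Fin m) (n : ℤ) (s : ℝ)
    (hs : lam ^ ((4 / 5 : ℝ) * j) * s + tstar ∈ Icc (0 : ℝ) T) :
    HasDerivWithinAt
      (fun r => lam ^ (-((1 / 5 : ℝ) * j)) * Z i (n - j) (lam ^ ((4 / 5 : ℝ) * j) * r + tstar))
      (rhsF lam coeff
        (fun i' n' r => lam ^ (-((1 / 5 : ℝ) * j)) * Z i' (n' - j) (lam ^ ((4 / 5 : ℝ) * j) * r + tstar))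
        i n s)
      ((fun r => lam ^ ((4 / 5 : ℝ) * j) * r + tstar) ⁻¹' Icc (0 : ℝ) T) s := by
  set b : ℝ := lam ^ ((4 / 5 : ℝ) * j) with hb
  set c : ℝ := lam ^ (-((1 / 5 : ℝ) * j)) with hc
  have hφ : HasDerivAt (fun r => b * r + tstar) b s := by
    simpa using ((hasDerivAt_id s).const_mul b).add_const tstar
  have hcomp := ((hZ i (n - j) (b * s + tstar) hs).comp s hφ.hasDerivWithinAt
    (mapsTo_preimage _ _)).const_mul c
  refine hcomp.congr_deriv ?_
  -- scale bookkeeping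
  have hlin : c * b * lam ^ ((4 / 5 : ℝ) * ((n - j : ℤ) : ℝ)) = lam ^ ((4 / 5 : ℝ) * (n : ℝ)) * c := by
    rw [hb, hc]; push_cast; simp only [← Real.rpow_add hpos]; congr 1; ring
  have hquad : ∀ (d co z₁ z₂ : ℝ),
      c * b * (co * lam ^ (((n - j : ℤ) : ℝ) - d) * z₁ * z₂) =
        co * lam ^ ((n : ℝ) - d) * (c * z₁) * (c * z₂) := by
    intro d co z₁ z₂
    have : c * b * lam ^ (((n - j : ℤ) : ℝ) - d) = lam ^ ((n : ℝ) - d) * c * c := by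
      rw [hb, hc]; push_cast; simp only [← Real.rpow_add hpos]; congr 1; ring
    calc c * b * (co * lam ^ (((n - j : ℤ) : ℝ) - d) * z₁ * z₂)
        = (c * b * lam ^ (((n - j : ℤ) : ℝ) - d)) * (co * z₁ * z₂) := by ring
      _ = _ := by rw [this]; ring
  have hidx : ∀ k : ℤ, n + k - j = n - j + k := fun k => by ring
  have hdist : ∀ L S : ℝ, c * ((L + S) * b) = c * b * L + c * b * S := fun L S => by ring
  simp only [rhsF, hidx]
  rw [hdist]
  simp only [Finset.mul_sum]
  congr 1
  · rw [show ∀ z : ℝ, c * b * (-(lam ^ ((4 / 5 : ℝ) * ((n - j : ℤ) : ℝ))) * z) =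
        -(c * b * lam ^ ((4 / 5 : ℝ) * ((n - j : ℤ) : ℝ))) * z from fun z => by ring, hlin]
    ring
  · exact Finset.sum_congr rfl fun i₁ _ => Finset.sum_congr rfl fun i₂ _ =>
      Finset.sum_congr rfl fun μ _ => hquad _ _ _ _

/-- **Stub E (`DssExtension`).** A one-period witness `Z` on `[0, T]` of the full lattice (solution
within `Icc 0 T`, relative periodicity `Z i (n+1) T = lam^{-1/5} Z i n 0`, weighted bound, nonzero
at time `0`) unrolls by the scaling symmetry of Tao's circuit class into an ancient solution `X`
which solves the circuit ODE on `(−∞, 0)`, is exactly `1`-DSS, Type I (constant `max C 0 · √t⋆`)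
and nontrivial (at `t = −t⋆`). [folklore] -/
theorem stub_dssExtension :
    ∀ (lam : ℝ), 1 < lam → ∀ (m : ℕ) (coeff : Fin m → Fin m → Fin m → Option (Fin 3) → ℝ)
    (T : ℝ) (Z : Fin m → ℤ → ℝ → ℝ), 0 < T →
    (∀ (i : Fin m) (n : ℤ), ∀ t ∈ Set.Icc (0 : ℝ) T,
      HasDerivWithinAt (Z i n)
        (Summit.NavierStokesRegularity.NavierStokesRegularity.Theorems.CircuitPumpNegative.rhsF
          lam coeff Z i n t) (Set.Icc (0 : ℝ) T) t) →
    (∀ (i : Fin m) (n : ℤ), Z i (n + 1) T = lam ^ (-(1 / 5 : ℝ)) * Z i n 0) →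
    (∃ C : ℝ, ∀ (i : Fin m) (n : ℤ), ∀ t ∈ Set.Icc (0 : ℝ) T, lam ^ ((3 / 5 : ℝ) * n) * |Z i n t| ≤ C) →
    (∃ (i : Fin m) (n : ℤ), Z i n 0 ≠ 0) →
    ∃ X : Fin m → ℤ → ℝ → ℝ,
      Summit.NavierStokesRegularity.NavierStokesRegularity.Theorems.CircuitPumpNegative.SolvesODE lam coeff X ∧
      Summit.NavierStokesRegularity.NavierStokesRegularity.Theorems.CircuitPumpNegative.IsDSS lam 1 X ∧
      Summit.NavierStokesRegularity.NavierStokesRegularity.Theorems.CircuitPumpNegative.IsTypeI lam X ∧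
      Summit.NavierStokesRegularity.NavierStokesRegularity.Theorems.CircuitPumpNegative.IsNontrivial X := by
  intro lam hlam m coeff T Z hT hZ hmatch hbd hnz
  obtain ⟨C, hC⟩ := hbd
  obtain ⟨i₀, n₀, hi₀⟩ := hnz
  have hpos : 0 < lam := by linarith
  -- the scale factor `lam^{4/5} > 1` and the blow-up time shift `t⋆`
  have hB1 : 1 < lam ^ (4 / 5 : ℝ) := Real.one_lt_rpow hlam (by norm_num)
  have hBpos : 0 < lam ^ (4 / 5 : ℝ) := by linarith
  obtain ⟨tstar, htstar⟩ : ∃ tstar : ℝ, tstar = T * lam ^ (4 / 5 : ℝ) / (lam ^ (4 / 5 : ℝ) - 1) :=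
    ⟨_, rfl⟩
  have htpos : 0 < tstar := by
    rw [htstar]; exact div_pos (mul_pos hT hBpos) (by linarith)
  have hkey : lam ^ (4 / 5 : ℝ) * (tstar - T) = tstar := by
    have hne : lam ^ (4 / 5 : ℝ) - 1 ≠ 0 := by linarith
    rw [htstar]; field_simp; ring
  have hTt : T - tstar < 0 := by nlinarith
  -- bookkeeping of the window scale `lam^{4j/5}` and amplitude `lam^{-j/5}`
  have hbpos : ∀ j : ℤ, 0 < lam ^ ((4 / 5 : ℝ) * j) := fun j => Real.rpow_pos_of_pos hpos _
  have hb_succ : ∀ j : ℤ, lam ^ ((4 / 5 : ℝ) * ((j + 1 : ℤ) : ℝ)) =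
      lam ^ ((4 / 5 : ℝ) * j) * lam ^ (4 / 5 : ℝ) := by
    intro j; push_cast; rw [mul_add, mul_one, Real.rpow_add hpos]
  have hb_pred : ∀ j : ℤ, lam ^ ((4 / 5 : ℝ) * j) =
      lam ^ ((4 / 5 : ℝ) * ((j - 1 : ℤ) : ℝ)) * lam ^ (4 / 5 : ℝ) := by
    intro j; have := hb_succ (j - 1); rwa [sub_add_cancel] at this
  have hc_succ : ∀ j : ℤ, lam ^ (-((1 / 5 : ℝ) * ((j + 1 : ℤ) : ℝ))) =
      lam ^ (-(1 / 5 : ℝ)) * lam ^ (-((1 / 5 : ℝ) * j)) := by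
    intro j; push_cast; rw [← Real.rpow_add hpos]; congr 1; ring
  have hbzpow : ∀ j : ℤ, lam ^ ((4 / 5 : ℝ) * j) = (lam ^ (4 / 5 : ℝ)) ^ j := by
    intro j; rw [Real.rpow_mul hpos.le, Real.rpow_intCast]
  -- the windows tile `(-∞, 0)`: existence of the window index ...
  have hcov : ∀ t : ℝ, ∃ j : ℤ, t < 0 → lam ^ ((4 / 5 : ℝ) * j) * t + tstar ∈ Ico 0 T := by
    intro t
    by_cases ht : t < 0
    · have hnt : 0 < -t := neg_pos.2 ht
      obtain ⟨j, hj1, hj2⟩ := exists_mem_Ico_zpow (div_pos htpos hnt) hB1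
      refine ⟨j, fun _ => ?_⟩
      rw [hbzpow]
      rw [le_div_iff₀ hnt] at hj1
      rw [div_lt_iff₀ hnt, zpow_add_one₀ hBpos.ne'] at hj2
      refine ⟨by linarith, ?_⟩
      have h1 : lam ^ (4 / 5 : ℝ) * (tstar - T) < lam ^ (4 / 5 : ℝ) * ((lam ^ (4 / 5 : ℝ)) ^ j * -t) := by
        rw [hkey]; linarith
      have h2 := lt_of_mul_lt_mul_left h1 hBpos.le
      linarith
    · exact ⟨0, fun h => absurd h ht⟩
  choose J hJ using hcov
  -- ... and its uniqueness
  have hmono : ∀ t : ℝ, t < 0 → ∀ j k : ℤ, j < k → lam ^ ((4 / 5 : ℝ) * j) * t + tstar < T →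
      ¬ 0 ≤ lam ^ ((4 / 5 : ℝ) * k) * t + tstar := by
    intro t ht j k hjk hjT hk0
    have hle : lam ^ ((4 / 5 : ℝ) * ((j + 1 : ℤ) : ℝ)) ≤ lam ^ ((4 / 5 : ℝ) * k) := by
      refine Real.rpow_le_rpow_of_exponent_le hlam.le ?_
      have : ((j + 1 : ℤ) : ℝ) ≤ k := by exact_mod_cast hjk
      linarith
    rw [hb_succ] at hle
    have h1 : lam ^ ((4 / 5 : ℝ) * k) * t ≤ lam ^ ((4 / 5 : ℝ) * j) * lam ^ (4 / 5 : ℝ) * t :=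
      mul_le_mul_of_nonpos_right hle ht.le
    have h2 : lam ^ (4 / 5 : ℝ) * (lam ^ ((4 / 5 : ℝ) * j) * t) < lam ^ (4 / 5 : ℝ) * (T - tstar) :=
      mul_lt_mul_of_pos_left (by linarith) hBpos
    linarith
  have huniq : ∀ t : ℝ, t < 0 → ∀ j : ℤ, lam ^ ((4 / 5 : ℝ) * j) * t + tstar ∈ Ico 0 T → J t = j := by
    intro t ht j hj
    obtain ⟨h0, hT'⟩ := hJ t ht
    rcases lt_trichotomy (J t) j with h | h | h
    · exact absurd hj.1 (hmono t ht _ _ h hT')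
    · exact h
    · exact absurd h0 (hmono t ht _ _ h hj.2)
  -- the witness
  obtain ⟨X, hXdef⟩ : ∃ X : Fin m → ℤ → ℝ → ℝ, ∀ i n t, X i n t =
      lam ^ (-((1 / 5 : ℝ) * J t)) * Z i (n - J t) (lam ^ ((4 / 5 : ℝ) * J t) * t + tstar) :=
    ⟨_, fun _ _ _ => rfl⟩
  -- `X` coincides with piece `j` on the whole CLOSED window `j` (relative periodicity at the right end)
  have hagree : ∀ (j : ℤ) (s : ℝ), lam ^ ((4 / 5 : ℝ) * j) * s + tstar ∈ Icc 0 T →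
      ∀ (i : Fin m) (n : ℤ),
        X i n s = lam ^ (-((1 / 5 : ℝ) * j)) * Z i (n - j) (lam ^ ((4 / 5 : ℝ) * j) * s + tstar) := by
    intro j s hs i n
    have hs0 : s < 0 := by
      by_contra h
      have : 0 ≤ lam ^ ((4 / 5 : ℝ) * j) * s := mul_nonneg (hbpos j).le (not_lt.1 h)
      linarith [hs.2]
    rcases hs.2.lt_or_eq with hlt | heq
    · rw [hXdef, huniq s hs0 j ⟨hs.1, hlt⟩]
    · have hu1 : lam ^ ((4 / 5 : ℝ) * ((j + 1 : ℤ) : ℝ)) * s + tstar = 0 := by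
        rw [hb_succ]
        have : lam ^ ((4 / 5 : ℝ) * j) * s = T - tstar := by linarith
        calc lam ^ ((4 / 5 : ℝ) * j) * lam ^ (4 / 5 : ℝ) * s + tstar
            = lam ^ (4 / 5 : ℝ) * (lam ^ ((4 / 5 : ℝ) * j) * s) + tstar := by ring
          _ = 0 := by rw [this]; linarith
      rw [hXdef, huniq s hs0 (j + 1) (by rw [hu1]; exact ⟨le_rfl, hT⟩), hu1, heq]
      have hm := hmatch i (n - (j + 1))
      rw [show n - (j + 1) + 1 = n - j by ring] at hm
      rw [hm, hc_succ]
      ring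
  have hφc : ∀ j : ℤ, Continuous fun r : ℝ => lam ^ ((4 / 5 : ℝ) * j) * r + tstar := by
    intro j; fun_prop
  have hφmono : ∀ (j : ℤ) (r₁ r₂ : ℝ), r₁ ≤ r₂ →
      lam ^ ((4 / 5 : ℝ) * j) * r₁ + tstar ≤ lam ^ ((4 / 5 : ℝ) * j) * r₂ + tstar :=
    fun j r₁ r₂ h => add_le_add (mul_le_mul_of_nonneg_left h (hbpos j).le) le_rfl
  refine ⟨X, ?_, ?_, ?_, ?_⟩
  · -- the ODE on `(-∞, 0)`
    intro i n t ht
    have hpiece : ∀ (j : ℤ) (s : ℝ), lam ^ ((4 / 5 : ℝ) * j) * s + tstar ∈ Icc 0 T →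
        HasDerivWithinAt (X i n) (rhsF lam coeff X i n s)
          ((fun r => lam ^ ((4 / 5 : ℝ) * j) * r + tstar) ⁻¹' Icc (0 : ℝ) T) s := by
      intro j s hs
      have h := piece_hasDerivWithinAt hpos coeff T tstar Z hZ j i n s hs
      have hrhs : rhsF lam coeff (fun i' n' r => lam ^ (-((1 / 5 : ℝ) * j)) *
          Z i' (n' - j) (lam ^ ((4 / 5 : ℝ) * j) * r + tstar)) i n s = rhsF lam coeff X i n s := by
        simp only [rhsF, hagree j s hs]
      rw [hrhs] at h
      exact h.congr (fun r hr => hagree j r hr i n) (hagree j s hs i n)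
    obtain ⟨hu0, huT⟩ := hJ t ht
    have hright : HasDerivWithinAt (X i n) (rhsF lam coeff X i n t) (Ici t) t := by
      refine (hpiece (J t) t ⟨hu0, huT.le⟩).mono_of_mem_nhdsWithin ?_
      have h1 : (fun r => lam ^ ((4 / 5 : ℝ) * J t) * r + tstar) ⁻¹' Iio T ∈ 𝓝 t :=
        (hφc (J t)).continuousAt.preimage_mem_nhds (Iio_mem_nhds huT)
      filter_upwards [inter_mem_nhdsWithin (Ici t) h1] with r hr
      exact ⟨hu0.trans (hφmono _ _ _ hr.1), le_of_lt hr.2⟩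
    have hleft : HasDerivWithinAt (X i n) (rhsF lam coeff X i n t) (Iic t) t := by
      rcases hu0.lt_or_eq with h0 | h0
      · refine (hpiece (J t) t ⟨hu0, huT.le⟩).mono_of_mem_nhdsWithin ?_
        have h1 : (fun r => lam ^ ((4 / 5 : ℝ) * J t) * r + tstar) ⁻¹' Ioi 0 ∈ 𝓝 t :=
          (hφc (J t)).continuousAt.preimage_mem_nhds (Ioi_mem_nhds h0)
        filter_upwards [inter_mem_nhdsWithin (Iic t) h1] with r hr
        exact ⟨le_of_lt hr.2, (hφmono _ _ _ hr.1).trans huT.le⟩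
      · -- junction: `t` is the left end of window `J t`, i.e. the right end of window `J t - 1`
        have hTj : lam ^ ((4 / 5 : ℝ) * ((J t - 1 : ℤ) : ℝ)) * t + tstar = T := by
          have e1 : lam ^ (4 / 5 : ℝ) * (lam ^ ((4 / 5 : ℝ) * ((J t - 1 : ℤ) : ℝ)) * t) =
              lam ^ (4 / 5 : ℝ) * (T - tstar) := by
            calc lam ^ (4 / 5 : ℝ) * (lam ^ ((4 / 5 : ℝ) * ((J t - 1 : ℤ) : ℝ)) * t)
                = lam ^ ((4 / 5 : ℝ) * ((J t - 1 : ℤ) : ℝ)) * lam ^ (4 / 5 : ℝ) * t := by ring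
              _ = lam ^ ((4 / 5 : ℝ) * J t) * t := by rw [← hb_pred]
              _ = lam ^ (4 / 5 : ℝ) * (T - tstar) := by linarith
          have e2 := mul_left_cancel₀ hBpos.ne' e1
          linarith
        refine (hpiece (J t - 1) t (by rw [hTj]; exact ⟨hT.le, le_rfl⟩)).mono_of_mem_nhdsWithin ?_
        have h1 : (fun r => lam ^ ((4 / 5 : ℝ) * ((J t - 1 : ℤ) : ℝ)) * r + tstar) ⁻¹' Ioi 0 ∈ 𝓝 t :=
          (hφc (J t - 1)).continuousAt.preimage_mem_nhds (Ioi_mem_nhds (by rw [hTj]; exact hT))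
        filter_upwards [inter_mem_nhdsWithin (Iic t) h1] with r hr
        exact ⟨le_of_lt hr.2, (hφmono _ _ _ hr.1).trans hTj.le⟩
    have := hleft.union hright
    rwa [Iic_union_Ici, hasDerivWithinAt_univ] at this
  · -- exact self-similarity with period 1
    intro i n t ht
    simp only [Nat.cast_one, mul_one]
    have ht' : lam ^ (-(4 / 5 : ℝ)) * t < 0 := mul_neg_of_pos_of_neg (Real.rpow_pos_of_pos hpos _) ht
    have hinv : lam ^ (-(4 / 5 : ℝ)) * lam ^ (4 / 5 : ℝ) = 1 := by
      rw [← Real.rpow_add hpos]; norm_num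
    have hu : lam ^ ((4 / 5 : ℝ) * ((J t + 1 : ℤ) : ℝ)) * (lam ^ (-(4 / 5 : ℝ)) * t) + tstar =
        lam ^ ((4 / 5 : ℝ) * J t) * t + tstar := by
      rw [hb_succ]
      calc lam ^ ((4 / 5 : ℝ) * J t) * lam ^ (4 / 5 : ℝ) * (lam ^ (-(4 / 5 : ℝ)) * t) + tstar
          = lam ^ ((4 / 5 : ℝ) * J t) * (lam ^ (-(4 / 5 : ℝ)) * lam ^ (4 / 5 : ℝ)) * t + tstar := by
            ring
        _ = _ := by rw [hinv, mul_one]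
    have hJ' : J (lam ^ (-(4 / 5 : ℝ)) * t) = J t + 1 :=
      huniq _ ht' _ (by rw [hu]; exact hJ t ht)
    rw [hXdef, hXdef, hJ', hu, show n + 1 - (J t + 1) = n - J t by ring, hc_succ]
    ring
  · -- Type I with constant `max C 0 · √t⋆`
    refine ⟨max C 0 * Real.sqrt tstar, fun i n t ht => ?_⟩
    obtain ⟨hu0, huT⟩ := hJ t ht
    have hnt : 0 < -t := by linarith
    rw [hXdef, le_div_iff₀ (Real.sqrt_pos.2 hnt), abs_mul, abs_of_pos (Real.rpow_pos_of_pos hpos _)]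
    have hZb : lam ^ ((3 / 5 : ℝ) * ((n - J t : ℤ) : ℝ)) *
        |Z i (n - J t) (lam ^ ((4 / 5 : ℝ) * J t) * t + tstar)| ≤ max C 0 :=
      (hC i (n - J t) _ ⟨hu0, huT.le⟩).trans (le_max_left _ _)
    have hsqrt : lam ^ ((2 / 5 : ℝ) * J t) * Real.sqrt (-t) ≤ Real.sqrt tstar := by
      rw [show lam ^ ((2 / 5 : ℝ) * J t) = Real.sqrt (lam ^ ((4 / 5 : ℝ) * J t)) by
          rw [Real.sqrt_eq_rpow, ← Real.rpow_mul hpos.le]; congr 1; ring,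
        ← Real.sqrt_mul (hbpos _).le]
      exact Real.sqrt_le_sqrt (by linarith)
    have hexp : lam ^ ((3 / 5 : ℝ) * n) * lam ^ (-((1 / 5 : ℝ) * J t)) =
        lam ^ ((2 / 5 : ℝ) * J t) * lam ^ ((3 / 5 : ℝ) * ((n - J t : ℤ) : ℝ)) := by
      push_cast; simp only [← Real.rpow_add hpos]; congr 1; ring
    calc lam ^ ((3 / 5 : ℝ) * n) * (lam ^ (-((1 / 5 : ℝ) * J t)) *
          |Z i (n - J t) (lam ^ ((4 / 5 : ℝ) * J t) * t + tstar)|) * Real.sqrt (-t)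
        = (lam ^ ((2 / 5 : ℝ) * J t) * Real.sqrt (-t)) * (lam ^ ((3 / 5 : ℝ) * ((n - J t : ℤ) : ℝ)) *
            |Z i (n - J t) (lam ^ ((4 / 5 : ℝ) * J t) * t + tstar)|) := by
          rw [← mul_assoc, hexp]; ring
      _ ≤ Real.sqrt tstar * max C 0 :=
          mul_le_mul hsqrt hZb (by positivity) (Real.sqrt_nonneg _)
      _ = max C 0 * Real.sqrt tstar := mul_comm _ _
  · -- nontrivial at `t = -t⋆`
    refine ⟨i₀, n₀, -tstar, by linarith, ?_⟩
    have h0 : lam ^ ((4 / 5 : ℝ) * ((0 : ℤ) : ℝ)) * -tstar + tstar = 0 := by simp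
    have hJ0 : J (-tstar) = 0 := huniq _ (by linarith) 0 (by rw [h0]; exact ⟨le_rfl, hT⟩)
    rw [hXdef, hJ0, h0]
    simpa using hi₀

end Summit.NavierStokesRegularity.NavierStokesRegularity.Theorems.PerpetualPumpCircuitPump

end
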